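import Summits.CriticalPhenomena.PercolationContinuityZ3.Theorems.PercNearOneGluingNoHeavyQuantCornerLayerRestrict
import HarnessLib

/-!
# QUANT lane R8, T-DEC: THE TOP CORNER RUN IS A STAIRCASE (census-2 g58) — two segments `(l, h)`, `(l′, h′)` of the corner flow with `l < l′`
# have `h′ ≤ h`

builds on p205010 (kernel theorem, internal audit signed; external expert review pending)

Support file (`--supports stmt-CriticalPhenomena-4575`), QUANT lane seat prim-quant-census-2 (gen 58), rung R8 of
`run/shared/lean/prim/quant/LADDER.md`.  One theorem, standard axioms, no sorries.  Memo `…/prim-quant-census-2-g58/EXTREME-ATOMS-G58.md` §1.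

* **`LawDec.corner_staircase`** — if `0 < cornerMidFlow … l h`, `0 < cornerMidFlow … l′ h′` and `l < l′` then `h′ ≤ h`.  By the greedy
  characterisation `cornerMidFlow_char` (typer g23 / `…QuantCornerLayerRestrict`): the higher low `l′` is treated first and takes the compatible
  mids upwards; since it still has mass at `h′ > h`, its stage at `h` (compatible because `(l, h)` is and `l < l′`) was capacity-limited, i.e. it
  exhausted the capacity of `h` left by the lows above `l′`; the later low `l` then finds none.  Used by `…QuantWindowExtremeShape`: the two
  segments of a balanced atom at an extreme point are in staircase order (the atlas' "never the swapped assignment").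

[this work]; nothing here is cited as a published result.  The gluing rows served [cite: KozmaNitzan2024, Conjecture 3 (p. 15)]; product
measure [cite: Grimmett1999, §1.3 p. 10].
-/

noncomputable section

namespace Summit.CriticalPhenomena.PercolationContinuityZ3.Theorems

namespace Quant

open Finset

namespace LawDec

/-- **THE TOP CORNER RUN IS A STAIRCASE**: two segments `(l, h)`, `(l′, h′)` with positive corner flow and `l < l′` have `h′ ≤ h` — the higher
low is treated first and exhausts every lower compatible mid before it moves up (`cornerMidFlow_char`), so a lower low finds no capacity
there. [this work] -/
theorem corner_staircase (x T : ℝ) (j M : ℕ) (μ : ℕ → ℝ) (hx0 : 0 < x) (hx1 : x < 1) (hμ : ∀ k, 0 ≤ μ k)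
    (l h l' h' : ℕ) (hF : 0 < cornerMidFlow x T j M μ l h) (hF' : 0 < cornerMidFlow x T j M μ l' h') (hll : l < l') :
    h' ≤ h := by
  classical
  obtain ⟨hF0, hsup, hrow, hcol⟩ := cornerFlow_inv x T j M μ hx0 hx1 hμ ((j + 1) * (j + 1)) le_rfl
  obtain ⟨q1, q2, q3, q4, q5, -⟩ := hsup l h (ne_of_gt hF)
  obtain ⟨p1, p2, p3, p4, p5, -⟩ := hsup l' h' (ne_of_gt hF')
  have hF0' : ∀ a b, 0 ≤ cornerMidFlow x T j M μ a b := fun a b => hF0 a b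
  have hterm0 : ∀ a b, 0 ≤ usage x T j a b * cornerMidFlow x T j M μ a b := fun a b => by
    by_cases hz : cornerMidFlow x T j M μ a b = 0
    · rw [hz, mul_zero]
    · obtain ⟨-, -, r3, -, r5, -⟩ := hsup a b hz
      have hab : a < b := by
        by_contra hge; push Not at hge
        have : (b : ℝ) ≤ a := by exact_mod_cast hge
        linarith
      exact mul_nonneg (usage_pos_of_compat x T j a b hx0 hx1 r3 hab (Or.inr r5)).le (hF0 a b)
  by_contra hlt
  push Not at hlt
  have hll' : (l : ℝ) < l' := by exact_mod_cast hll
  have hadm : 2 * (l' : ℝ) < T ∧ h ≤ M ∧ T < (l' : ℝ) + h := ⟨p3, q4, by linarith⟩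
  have hl'h : l' < h := by
    by_contra hge; push Not at hge
    have : (h : ℝ) ≤ l' := by exact_mod_cast hge
    linarith
  have hc'pos : 0 < usage x T j l' h := usage_pos_of_compat x T j l' h hx0 hx1 p3 hl'h (Or.inr hadm.2.2)
  have hcpos : 0 < usage x T j l h := usage_pos_of_compat x T j l h hx0 hx1 q3 (by
    by_contra hge; push Not at hge
    have : (h : ℝ) ≤ l := by exact_mod_cast hge
    linarith) (Or.inr q5)
  -- the characterisations at (l′, h′), (l′, h) and (l, h)
  have hch' := cornerMidFlow_char x T j M μ hx0 hx1 hμ l' h' p1 p2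
  rw [if_pos ⟨p3, p4, p5⟩] at hch'
  have hch := cornerMidFlow_char x T j M μ hx0 hx1 hμ l' h p1 q2
  rw [if_pos hadm] at hch
  have hchl := cornerMidFlow_char x T j M μ hx0 hx1 hμ l h q1 q2
  rw [if_pos ⟨q3, q4, q5⟩] at hchl
  -- (1) the remaining mass of `l′` before `h′` is positive
  have hA' : 0 < μ l' - ∑ h'' ∈ Finset.range (M + 1), (if h'' < h' then cornerMidFlow x T j M μ l' h'' else 0) := by
    have := min_le_left (μ l' - ∑ h'' ∈ Finset.range (M + 1), (if h'' < h' then cornerMidFlow x T j M μ l' h'' else 0))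
      ((μ h' - ∑ l'' ∈ Finset.range (j + 1), (if l' < l'' then usage x T j l'' h' * cornerMidFlow x T j M μ l'' h' else 0))
        / usage x T j l' h')
    rw [← hch'] at this
    linarith
  -- (2) the sum before `h′` dominates the sum before `h` plus the entry at `h`
  have hsplit : ∑ h'' ∈ Finset.range (M + 1), (if h'' < h' then cornerMidFlow x T j M μ l' h'' else 0)
      ≥ ∑ h'' ∈ Finset.range (M + 1), (if h'' < h then cornerMidFlow x T j M μ l' h'' else 0) + cornerMidFlow x T j M μ l' h := by
    have e : ∀ h'', (if h'' < h' then cornerMidFlow x T j M μ l' h'' else 0)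
        = (if h'' < h then cornerMidFlow x T j M μ l' h'' else 0)
          + (if h ≤ h'' ∧ h'' < h' then cornerMidFlow x T j M μ l' h'' else 0) := by
      intro h''
      by_cases a : h'' < h
      · rw [if_pos (lt_trans a hlt), if_pos a, if_neg (fun c => by omega), add_zero]
      · by_cases b : h'' < h'
        · rw [if_pos b, if_neg a, if_pos ⟨not_lt.1 a, b⟩, zero_add]
        · rw [if_neg b, if_neg a, if_neg (fun c => b c.2), add_zero]
    simp_rw [e]
    rw [Finset.sum_add_distrib]
    have hle := Finset.single_le_sum (f := fun h'' => (if h ≤ h'' ∧ h'' < h' then cornerMidFlow x T j M μ l' h'' else 0))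
      (fun h'' _ => by
        show 0 ≤ (if h ≤ h'' ∧ h'' < h' then cornerMidFlow x T j M μ l' h'' else 0)
        split_ifs
        · exact hF0' l' h''
        · exact le_rfl)
      (Finset.mem_range.2 (Nat.lt_succ_of_le q4))
    have eh : (if h ≤ h ∧ h < h' then cornerMidFlow x T j M μ l' h else 0) = cornerMidFlow x T j M μ l' h := if_pos ⟨le_rfl, hlt⟩
    rw [eh] at hle
    linarith
  -- (3) hence the stage `(l′, h)` was capacity-limited: `usage(l′,h)·F(l′,h) = remaining capacity of h after the lows above l′`
  have hcap : usage x T j l' h * cornerMidFlow x T j M μ l' h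
      = μ h - ∑ l'' ∈ Finset.range (j + 1), (if l' < l'' then usage x T j l'' h * cornerMidFlow x T j M μ l'' h else 0) := by
    set A := μ l' - ∑ h'' ∈ Finset.range (M + 1), (if h'' < h then cornerMidFlow x T j M μ l' h'' else 0) with hA
    set B := μ h - ∑ l'' ∈ Finset.range (j + 1), (if l' < l'' then usage x T j l'' h * cornerMidFlow x T j M μ l'' h else 0) with hB
    have hltA : cornerMidFlow x T j M μ l' h < A := by rw [hA]; linarith
    have hmin : cornerMidFlow x T j M μ l' h = min A (B / usage x T j l' h) := hch
    have : min A (B / usage x T j l' h) = B / usage x T j l' h := by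
      rcases min_choice A (B / usage x T j l' h) with e | e
      · exfalso; rw [← hmin] at e; linarith
      · exact e
    rw [hmin, this]
    field_simp
  -- (4) so at the stage `(l, h)` no capacity is left
  have hcol_l : μ h ≤ ∑ l'' ∈ Finset.range (j + 1), (if l < l'' then usage x T j l'' h * cornerMidFlow x T j M μ l'' h else 0) := by
    have e : ∀ l'', (if l < l'' then usage x T j l'' h * cornerMidFlow x T j M μ l'' h else 0)
        = (if l' < l'' then usage x T j l'' h * cornerMidFlow x T j M μ l'' h else 0)
          + (if l < l'' ∧ l'' ≤ l' then usage x T j l'' h * cornerMidFlow x T j M μ l'' h else 0) := by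
      intro l''
      by_cases a : l' < l''
      · rw [if_pos (lt_trans hll a), if_pos a, if_neg (fun c => by omega), add_zero]
      · by_cases b : l < l''
        · rw [if_pos b, if_neg a, if_pos ⟨b, not_lt.1 a⟩, zero_add]
        · rw [if_neg b, if_neg a, if_neg (fun c => b c.1), add_zero]
    simp_rw [e]
    rw [Finset.sum_add_distrib]
    have hle := Finset.single_le_sum
      (f := fun l'' => (if l < l'' ∧ l'' ≤ l' then usage x T j l'' h * cornerMidFlow x T j M μ l'' h else 0))
      (fun l'' _ => by
        show 0 ≤ (if l < l'' ∧ l'' ≤ l' then usage x T j l'' h * cornerMidFlow x T j M μ l'' h else 0)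
        split_ifs
        · exact hterm0 l'' h
        · exact le_rfl)
      (Finset.mem_range.2 (Nat.lt_succ_of_le p1))
    have el : (if l < l' ∧ l' ≤ l' then usage x T j l' h * cornerMidFlow x T j M μ l' h else 0)
        = usage x T j l' h * cornerMidFlow x T j M μ l' h := if_pos ⟨hll, le_rfl⟩
    rw [el] at hle
    linarith
  -- (5) contradiction: `F(l, h) ≤ (nonpositive capacity)/usage ≤ 0`
  have hle := min_le_right (μ l - ∑ h'' ∈ Finset.range (M + 1), (if h'' < h then cornerMidFlow x T j M μ l h'' else 0))
    ((μ h - ∑ l'' ∈ Finset.range (j + 1), (if l < l'' then usage x T j l'' h * cornerMidFlow x T j M μ l'' h else 0))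
      / usage x T j l h)
  rw [← hchl] at hle
  have hnum : (μ h - ∑ l'' ∈ Finset.range (j + 1), (if l < l'' then usage x T j l'' h * cornerMidFlow x T j M μ l'' h else 0))
      / usage x T j l h ≤ 0 := div_nonpos_of_nonpos_of_nonneg (by linarith) hcpos.le
  linarith


end LawDec

end Quant

end Summit.CriticalPhenomena.PercolationContinuityZ3.Theorems
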